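import Literature.Algebra.EuclideanLattices.GapInstanceCodeFP
import Literature.Algebra.EuclideanLattices.GapCVPVerifier
import HarnessLib

/-!
# Reading a `GapCVP` instance code in polynomial time (typed `FP`)

Topic `Algebra/EuclideanLattices` (family `pqc`), sequel of `GapInstanceCodeFP.lean` (readers of `GapSVP`
codes `GapCodes.svp*_codeFP`, writer `cvpCode` of `GapCVP` codes). A reduction FROM `GapCVP` / `GapCVP′` — the
machine of Micciancio–Regev's Thm. 5.23 (`Literature.Computability.Cryptography.MicciancioRegev2007_gapCVP'_to_SIS'`)
— reads `code ((B, t), d)`; this file supplies the typed projections from the INSTANCE CODE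
`GapCVPInstance.encode = gapCVPInstanceEncoding.encode`, all PROVED:

* `GapCodes.cvpTup p = ((n, (row-major entries of B, [t₀, …])), (num d, den d))` with
  `GapCVPInstance.encode p = cvpTupE (cvpTup p)` (`encode_eq_cvpTupE`), `cvpTupFP`;
* `cvpN_codeFP` (binary `n`), `cvpNUn_codeFP` (unary `n`, `n ≤ |code|`), `cvpFlat_codeFP`, `cvpRows_codeFP`
  (the basis as the list matrix `rowsOfFlat`, `= matRows B`, `cvpRows_eq_matRows`), `cvpTarget_codeFP`
  (`[t₀, …, t_{n−1}]` in the difference-pair code), `cvpNum_codeFP`, `cvpDen_codeFP`, `cvpSelf_codeFP`;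
* `cvpLattice_codeFP` — the code of the lattice instance `B` alone (`LatticeInstance.encode p.1.I`), the input
  of the dual loop `MRLemma510.runOn`.

## References

* D. Micciancio, S. Goldwasser, *Complexity of Lattice Problems*, Kluwer 2002, Ch. 1 Def. 1.5 / §1.2 (codes of
  `GapCVP` instances) [MicciancioGoldwasser2002].
* S. Arora, B. Barak, *Computational Complexity: A Modern Approach*, CUP 2009, §0.1, §1.3 [AroraBarak2009].
-/

namespace Literature.Algebra.EuclideanLattices

open _root_.Computability Literature.Computability.Complexity Literature.Computability.Complexity.CodeFP
  Literature.Computability.Complexity.LMat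

namespace GapCodes

/-! ### Reading a `GapCVP` instance code -/

/-- The typed data of a `GapCVP` instance: `((n, (row-major entries of B, target entries)), (num d, den d))`.
[cite: MicciancioGoldwasser2002, Ch. 1 §1.2] -/
def cvpTup (p : GapCVPInstance) : (ℕ × (List ℤ × List ℤ)) × (ℤ × ℕ) :=
  ((p.1.I.n, (rowMajor p.1.I.n (matRows p.1.I.basis), List.ofFn p.1.target)), (p.2.num, p.2.den))

/-- The structured code of the typed data. [folklore] -/
abbrev cvpTupE : (ℕ × (List ℤ × List ℤ)) × (ℤ × ℕ) → List Bool :=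
  pairE (pairE natE (pairE (listE smE) (listE smE))) (pairE smE natE)

/-- **The instance code is the structured code of the typed data.** [cite: MicciancioGoldwasser2002, Ch. 1 Def. 1.5 / §1.2] -/
theorem encode_eq_cvpTupE (p : GapCVPInstance) : GapCVPInstance.encode p = cvpTupE (cvpTup p) := by
  obtain ⟨⟨⟨n, B⟩, t⟩, d⟩ := p
  have h := gapCVPInstance_encode_toMat n (matRows B) t d
  rw [toMat_matRows] at h
  rw [h]
  rfl

/-- The typed data are read off the instance code in polynomial time. [cite: AroraBarak2009, §1.3] -/
theorem cvpTupFP : CodeFP GapCVPInstance.encode cvpTupE cvpTup :=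
  (CodeFP.id GapCVPInstance.encode).recodeOut encode_eq_cvpTupE

/-- The dimension (binary) from the code. [folklore] -/
theorem cvpN_codeFP : CodeFP GapCVPInstance.encode natE (fun p => p.1.I.n) := (cvpTupFP.fst'.fst' :)

/-- The threshold's numerator from the code. [folklore] -/
theorem cvpNum_codeFP : CodeFP GapCVPInstance.encode intE (fun p => p.2.num) := (intOfSM.comp cvpTupFP.snd'.fst' :)

/-- The threshold's denominator from the code. [folklore] -/
theorem cvpDen_codeFP : CodeFP GapCVPInstance.encode natE (fun p => p.2.den) := (cvpTupFP.snd'.snd' :)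

/-- The code itself as a string value (the ruler for unary conversions and yardsticks). [folklore] -/
theorem cvpSelf_codeFP : CodeFP GapCVPInstance.encode strE GapCVPInstance.encode :=
  (CodeFP.id GapCVPInstance.encode).recodeOut fun _ => rfl

/-- **The dimension in unary from the code** (`n ≤ |code|`, so the capped conversion is exact).
[cite: MicciancioGoldwasser2002, Ch. 1 §1.3] -/
theorem cvpNUn_codeFP : CodeFP GapCVPInstance.encode unE (fun p => p.1.I.n) := by
  have h := (unOfNatMin.comp ((strLength.comp cvpSelf_codeFP).pair cvpN_codeFP) :)
  refine h.congr fun p => min_eq_left ?_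
  obtain ⟨⟨I, t⟩, d⟩ := p
  exact n_le_length_encode_cvp (I := I) (t := t) (d := d)

/-- The row-major entry list of the basis (integers, difference-pair code) from the code. [folklore] -/
theorem cvpFlat_codeFP : CodeFP GapCVPInstance.encode (rawE intE) (fun p => rowMajor p.1.I.n (matRows p.1.I.basis)) := by
  have h := ((map₀ intOfSM).comp ((rawOfList smE).comp cvpTupFP.fst'.snd'.fst') :)
  exact h.congr fun p => by simp [cvpTup]

/-- **The basis rows from the instance code**, as the list matrix `rowsOfFlat n (row-major list)`. [cite: AroraBarak2009, §1.3] -/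
theorem cvpRows_codeFP : CodeFP GapCVPInstance.encode matE (fun p => rowsOfFlat p.1.I.n (rowMajor p.1.I.n (matRows p.1.I.basis))) :=
  (rowsOfFlat_codeFP.comp (cvpNUn_codeFP.pair cvpFlat_codeFP) :)

/-- The rows read off the code are the `ofFn` rows of the basis. [folklore] -/
theorem cvpRows_eq_matRows (p : GapCVPInstance) :
    rowsOfFlat p.1.I.n (rowMajor p.1.I.n (matRows p.1.I.basis)) = matRows p.1.I.basis :=
  rowsOfFlat_rowMajor_matRows p.1.I.basis

/-- **The target from the instance code**: `[t₀, …, t_{n−1}]` (difference-pair code). [folklore] -/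
theorem cvpTarget_codeFP : CodeFP GapCVPInstance.encode (rawE intE) (fun p => List.ofFn p.1.target) := by
  have h := ((map₀ intOfSM).comp ((rawOfList smE).comp cvpTupFP.fst'.snd'.snd') :)
  exact h.congr fun p => by simp [cvpTup]

/-- **The code of the lattice instance alone** (`code B = ⟨bin n, listE smE (row-major B)⟩`), the input of the
dual loop of Cor. 5.13. [cite: MicciancioGoldwasser2002, Ch. 1 §1.2] -/
theorem cvpLattice_codeFP : CodeFP GapCVPInstance.encode LatticeInstance.encode (fun p => p.1.I) := by
  have h := (cvpTupFP.fst'.fst'.pair cvpTupFP.fst'.snd'.fst' :)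
  refine h.recodeOut fun p => ?_
  obtain ⟨⟨⟨n, B⟩, t⟩, d⟩ := p
  have hI : LatticeInstance.encode ⟨n, B⟩ = boolPair (encodeNat n) (listE smE (rowMajor n (matRows B))) := by
    have := latticeInstance_encode_toMat n (matRows B)
    rwa [toMat_matRows] at this
  rw [hI]
  rfl

end GapCodes

end Literature.Algebra.EuclideanLattices
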